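import Literature.AlgebraicGeometry.Limits.LocalizationTwoOpensCharts
import HarnessLib

/-!
# Limits of schemes: gluing two descended charts (Stacks 01ZM for two opens)

Topic: `Literature/AlgebraicGeometry/Limits`. Let `B = A_S` and let `X` be a `B`-scheme covered by
two open charts `u₁ : P₁ ×_A Spec B → X`, `u₂ : P₂ ×_A Spec B → X` which are base changes of
`A`-schemes `P₁, P₂` (quasi-compact, quasi-separated, locally of finite presentation). Suppose the
overlap has been descended: open immersions `ιᵢ : Qᵢ → Pᵢ` over `A`, an identification
`θ : Q₁ ⊗ Spec B ≅ Q₂ ⊗ Spec B` over `Spec B` compatible with the maps to `X`, with ranges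
`U ∩ V`, and — by the compatible spreading out of isomorphisms
(`Limits/LocalizationIsoSpreadCompat`) — an isomorphism `e : Q₁ ⊗ Spec A[1/t] ≅ Q₂ ⊗ Spec A[1/t]`
over `Spec A[1/t]` restricting to `θ`. **Then `X` is the base change of the `A`-scheme
`glued = (P₁ ⊗ Spec A[1/t]) ⨿_{Q₁ ⊗ Spec A[1/t]} (P₂ ⊗ Spec A[1/t])`** (pushout along the open
immersions `ι₁ ⊗ 1` and `e ≫ (ι₂ ⊗ 1)`), which is again quasi-compact, quasi-separated and locally
of finite presentation (`exists_iso_pullback_glued`). The comparison map `X → glued ⊗ Spec B` is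
glued from the two charts (they agree on the overlap because `e` restricts to `θ`), and it is an
isomorphism because over each of the two charts of `glued ⊗ Spec B` it restricts to an
isomorphism (the preimage of a chart is exactly the corresponding chart of `X`, as the two charts
of the pushout meet exactly in `Q₁ ⊗ Spec A[1/t]`). This is the induction step of the proof of
EGA IV₃ 8.8.2 (ii) / Stacks 01ZM for `Spec A_S = lim Spec A[1/s]`
(`Limits/LocalizationSchemeDescent`).

## References

* A. Grothendieck, EGA IV₃, Thm. 8.8.2 (ii) (Publ. Math. IHÉS 28, 1966). [EGAIV3]
* The Stacks project, Tag 01ZM. [StacksProject]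
* U. Görtz, T. Wedhorn, *Algebraic Geometry I: Schemes*, 2nd ed. (2020), Thm. 10.66. [GortzWedhorn2020]
-/

noncomputable section

universe u

open CategoryTheory CategoryTheory.Limits AlgebraicGeometry TopologicalSpace MonoidalCategory
  CartesianMonoidalCategory
open Opposite

namespace Literature.AlgebraicGeometry.Limits

namespace LocApprox

open Literature.AlgebraicGeometry.Motives (SchemeOver specOver)

set_option backward.isDefEq.respectTransparency false

variable {A : Type u} [CommRing A] {S : Submonoid A} {B : Type u} [CommRing B] [Algebra A B]
  [IsLocalization S B]

/-- The stages `P ⊗ Spec A[1/s] → Spec A` are locally of finite presentation if `P → Spec A` is.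
[folklore] -/
instance locallyOfFinitePresentation_tensorObj_baseDiagram_hom (P : SchemeOver A)
    [LocallyOfFinitePresentation P.hom] (s : Idx S) :
    LocallyOfFinitePresentation (P ⊗ (baseDiagram S).obj s).hom := by
  rw [Over.tensorObj_hom]
  infer_instance

section Glue

variable {P₁ P₂ Q₁ Q₂ : SchemeOver A} (ι₁ : Q₁ ⟶ P₁) (ι₂ : Q₂ ⟶ P₂)
  [IsOpenImmersion ι₁.left] [IsOpenImmersion ι₂.left] (t : Idx S)
  (e : Q₁ ⊗ (baseDiagram S).obj t ≅ Q₂ ⊗ (baseDiagram S).obj t)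

/-- `ι ⊗ T` is an open immersion on total spaces if `ι` is. [folklore] -/
instance isOpenImmersion_whiskerRight_left_of {Q P : SchemeOver A} (ι : Q ⟶ P)
    [IsOpenImmersion ι.left] (T : SchemeOver A) : IsOpenImmersion (ι ▷ T).left :=
  MorphismProperty.of_isPullback (P := @IsOpenImmersion) (isPullback_whiskerRight_left ι T).flip
    inferInstance

/-- The first gluing map `Q₁ ⊗ Spec A[1/t] → P₁ ⊗ Spec A[1/t]`. [folklore] -/
abbrev glueLeft : (Q₁ ⊗ (baseDiagram S).obj t).left ⟶ (P₁ ⊗ (baseDiagram S).obj t).left :=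
  (ι₁ ▷ (baseDiagram S).obj t).left

/-- The second gluing map `Q₁ ⊗ Spec A[1/t] ≅ Q₂ ⊗ Spec A[1/t] → P₂ ⊗ Spec A[1/t]`. [folklore] -/
abbrev glueRight : (Q₁ ⊗ (baseDiagram S).obj t).left ⟶ (P₂ ⊗ (baseDiagram S).obj t).left :=
  e.hom.left ≫ (ι₂ ▷ (baseDiagram S).obj t).left

omit [IsLocalization S B] [IsOpenImmersion ι₁.left] [IsOpenImmersion ι₂.left] in
/-- The two gluing maps are compatible with the structure maps to `Spec A`. [folklore] -/
theorem glueLeft_hom :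
    glueLeft ι₁ t ≫ (P₁ ⊗ (baseDiagram S).obj t).hom =
      glueRight ι₂ t e ≫ (P₂ ⊗ (baseDiagram S).obj t).hom := by
  rw [glueLeft, Over.w, glueRight, Category.assoc, Over.w, Over.w]

/-- **The glued `A`-scheme** `(P₁ ⊗ Spec A[1/t]) ⨿_{Q₁ ⊗ Spec A[1/t]} (P₂ ⊗ Spec A[1/t])`. [folklore] -/
def glued : SchemeOver A :=
  Over.mk (pushout.desc (P₁ ⊗ (baseDiagram S).obj t).hom (P₂ ⊗ (baseDiagram S).obj t).hom
    (glueLeft_hom ι₁ ι₂ t e))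

/-- The first chart `P₁ ⊗ Spec A[1/t] → glued` over `Spec A`. [folklore] -/
def gluedInl : P₁ ⊗ (baseDiagram S).obj t ⟶ glued ι₁ ι₂ t e :=
  Over.homMk (pushout.inl (glueLeft ι₁ t) (glueRight ι₂ t e)) (pushout.inl_desc _ _ _)

/-- The second chart `P₂ ⊗ Spec A[1/t] → glued` over `Spec A`. [folklore] -/
def gluedInr : P₂ ⊗ (baseDiagram S).obj t ⟶ glued ι₁ ι₂ t e :=
  Over.homMk (pushout.inr (glueLeft ι₁ t) (glueRight ι₂ t e)) (pushout.inr_desc _ _ _)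

/-- The pushout square, as an equation of morphisms over `Spec A`. [folklore] -/
theorem whiskerRight_gluedInl :
    (ι₁ ▷ (baseDiagram S).obj t) ≫ gluedInl ι₁ ι₂ t e =
      e.hom ≫ (ι₂ ▷ (baseDiagram S).obj t) ≫ gluedInr ι₁ ι₂ t e := by
  ext : 1
  exact pushout.condition

/-- The first chart is an open immersion on total spaces. [folklore] -/
instance isOpenImmersion_gluedInl_left : IsOpenImmersion (gluedInl ι₁ ι₂ t e).left :=
  isOpenImmersion_inl _ _

/-- The second chart is an open immersion on total spaces. [folklore] -/
instance isOpenImmersion_gluedInr_left : IsOpenImmersion (gluedInr ι₁ ι₂ t e).left :=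
  isOpenImmersion_inr _ _

variable [QuasiCompact P₁.hom] [QuasiSeparated P₁.hom] [LocallyOfFinitePresentation P₁.hom]
  [QuasiCompact P₂.hom] [QuasiSeparated P₂.hom] [LocallyOfFinitePresentation P₂.hom]
  [QuasiCompact Q₁.hom]

/-- `glued → Spec A` is quasi-compact. [folklore] -/
instance quasiCompact_glued_hom : QuasiCompact (glued ι₁ ι₂ t e).hom :=
  quasiCompact_pushoutDesc _ _ _ _ _

/-- `glued → Spec A` is quasi-separated (the two charts are, and they meet in the quasi-compact
`Q₁ ⊗ Spec A[1/t]`). [folklore] -/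
instance quasiSeparated_glued_hom : QuasiSeparated (glued ι₁ ι₂ t e).hom :=
  quasiSeparated_pushoutDesc _ _ _ _ _

/-- `glued → Spec A` is locally of finite presentation. [folklore] -/
instance locallyOfFinitePresentation_glued_hom : LocallyOfFinitePresentation (glued ι₁ ι₂ t e).hom :=
  locallyOfFinitePresentation_pushoutDesc _ _ _ _ _

end Glue

/-! ## The comparison map `X → glued ⊗ Spec B` -/

section Comparison

variable (B)
variable {X : SchemeOver B} {P₁ P₂ Q₁ Q₂ : SchemeOver A} (ι₁ : Q₁ ⟶ P₁) (ι₂ : Q₂ ⟶ P₂)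
  [IsOpenImmersion ι₁.left] [IsOpenImmersion ι₂.left] (t : Idx S)
  (e : Q₁ ⊗ (baseDiagram S).obj t ≅ Q₂ ⊗ (baseDiagram S).obj t)

/-- The comparison map on the first chart:
`P₁ ⊗ Spec B ≅ (P₁ ⊗ Spec A[1/t]) ⊗ Spec B → glued ⊗ Spec B`. [folklore] -/
def chartMap₁ : (P₁ ⊗ specOver A B).left ⟶ (glued ι₁ ι₂ t e ⊗ specOver A B).left :=
  (toStage S B P₁ t ≫ (gluedInl ι₁ ι₂ t e ▷ specOver A B)).left

/-- The comparison map on the second chart. [folklore] -/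
def chartMap₂ : (P₂ ⊗ specOver A B).left ⟶ (glued ι₁ ι₂ t e ⊗ specOver A B).left :=
  (toStage S B P₂ t ≫ (gluedInr ι₁ ι₂ t e ▷ specOver A B)).left

variable (θ : Q₁ ⊗ specOver A B ≅ Q₂ ⊗ specOver A B) (hθ : θ.hom ≫ snd _ _ = snd _ _)
  (hcomp : (Q₁ ◁ leg S B t) ≫ e.hom = θ.hom ≫ (Q₂ ◁ leg S B t))

include hθ hcomp in
/-- `e` restricts to `θ`, in terms of `toStage`. [folklore] -/
theorem toStage_whiskerRight_eq :
    toStage S B Q₁ t ≫ (e.hom ▷ specOver A B) = θ.hom ≫ toStage S B Q₂ t := by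
  refine CartesianMonoidalCategory.hom_ext _ _ ?_ ?_
  · rw [Category.assoc, whiskerRight_fst, ← Category.assoc, toStage_fst, hcomp, Category.assoc,
      toStage_fst]
  · rw [Category.assoc, whiskerRight_snd, toStage_snd, Category.assoc, toStage_snd, hθ]

include hθ hcomp in
/-- **The two comparison maps agree on the overlap** (because `e` restricts to `θ` and the
pushout square commutes). [folklore] -/
theorem whiskerRight_chartMap₁ :
    (ι₁ ▷ specOver A B).left ≫ chartMap₁ B ι₁ ι₂ t e =
      θ.hom.left ≫ (ι₂ ▷ specOver A B).left ≫ chartMap₂ B ι₁ ι₂ t e := by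
  change ((ι₁ ▷ specOver A B) ≫ toStage S B P₁ t ≫ (gluedInl ι₁ ι₂ t e ▷ specOver A B)).left =
    (θ.hom ≫ (ι₂ ▷ specOver A B) ≫ toStage S B P₂ t ≫ (gluedInr ι₁ ι₂ t e ▷ specOver A B)).left
  congr 1
  rw [← Category.assoc, whiskerRight_toStage, Category.assoc, ← comp_whiskerRight,
    whiskerRight_gluedInl, comp_whiskerRight, comp_whiskerRight, ← Category.assoc,
    toStage_whiskerRight_eq B t e θ hθ hcomp, Category.assoc, ← Category.assoc (toStage S B Q₂ t),
    ← whiskerRight_toStage, Category.assoc]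

variable (u₁ : (Over.pullback (specOver A B).hom).obj P₁ ⟶ X)
  (u₂ : (Over.pullback (specOver A B).hom).obj P₂ ⟶ X)
  [IsOpenImmersion u₁.left] [IsOpenImmersion u₂.left]
  (hψ : (ι₁ ▷ specOver A B).left ≫ u₁.left = θ.hom.left ≫ (ι₂ ▷ specOver A B).left ≫ u₂.left)
  (hrange : Set.range ((ι₁ ▷ specOver A B).left ≫ u₁.left) = Set.range u₁.left ∩ Set.range u₂.left)
  (hcov : Set.range u₁.left ∪ Set.range u₂.left = Set.univ)

/-- The two-chart open cover of `X`. [folklore] -/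
def twoCover : X.left.OpenCover :=
  Scheme.Cover.mkOfCovers Bool (fun b => bif b then (P₁ ⊗ specOver A B).left else (P₂ ⊗ specOver A B).left)
    (fun b => match b with
      | true => u₁.left
      | false => u₂.left)
    (fun x => by
      have hx : x ∈ Set.range u₁.left ∪ Set.range u₂.left := by rw [hcov]; trivial
      rcases hx with ⟨y, rfl⟩ | ⟨y, rfl⟩
      · exact ⟨true, y, rfl⟩
      · exact ⟨false, y, rfl⟩)
    (by rintro (_ | _) <;> dsimp only <;> infer_instance)

/-- The canonical map from the descended overlap to the overlap `U ×_X V` of the two charts.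
[folklore] -/
def toOverlap : (Q₁ ⊗ specOver A B).left ⟶ pullback u₁.left u₂.left :=
  pullback.lift (ι₁ ▷ specOver A B).left (θ.hom.left ≫ (ι₂ ▷ specOver A B).left)
    (by rw [hψ, Category.assoc])

include hrange in
omit [IsOpenImmersion ι₁.left] [IsOpenImmersion u₂.left] in
/-- The range of `ι₁ ⊗ Spec B` is the preimage of the second chart under `u₁`. [folklore] -/
theorem range_whiskerRight_left_eq : Set.range (ι₁ ▷ specOver A B).left = u₁.left ⁻¹' Set.range u₂.left := by
  have h : u₁.left ⁻¹' (Set.range ((ι₁ ▷ specOver A B).left ≫ u₁.left)) =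
      Set.range (ι₁ ▷ specOver A B).left := by
    rw [Scheme.Hom.comp_base, TopCat.coe_comp, Set.range_comp]
    exact Set.preimage_image_eq _ u₁.left.isOpenEmbedding.injective
  rw [← h, hrange, Set.preimage_inter, Set.preimage_range, Set.univ_inter]

include hrange in
omit [IsOpenImmersion ι₂.left] in
/-- `toOverlap` is an isomorphism: an open immersion (its composite with the open immersion
`U ×_X V → U` is one) which is surjective (ranges). [folklore] -/
theorem isIso_toOverlap : IsIso (toOverlap B ι₁ ι₂ θ u₁ u₂ hψ) := by
  have hfst : toOverlap B ι₁ ι₂ θ u₁ u₂ hψ ≫ pullback.fst u₁.left u₂.left =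
      (ι₁ ▷ specOver A B).left := pullback.lift_fst _ _ _
  haveI : IsOpenImmersion (toOverlap B ι₁ ι₂ θ u₁ u₂ hψ ≫ pullback.fst u₁.left u₂.left) := by
    rw [hfst]; infer_instance
  haveI : IsOpenImmersion (toOverlap B ι₁ ι₂ θ u₁ u₂ hψ) :=
    IsOpenImmersion.of_comp _ (pullback.fst u₁.left u₂.left)
  refine (isIso_iff_isOpenImmersion_and_epi_base _).mpr ⟨inferInstance, ?_⟩
  rw [TopCat.epi_iff_surjective]
  intro z
  have hz : pullback.fst u₁.left u₂.left z ∈ Set.range (ι₁ ▷ specOver A B).left := by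
    rw [range_whiskerRight_left_eq B ι₁ u₁ u₂ hrange, ← Scheme.Pullback.range_fst]
    exact ⟨z, rfl⟩
  obtain ⟨y, hy⟩ := hz
  refine ⟨y, (pullback.fst u₁.left u₂.left).isOpenEmbedding.injective ?_⟩
  rw [← hy, ← hfst]
  rfl

include hθ hcomp hψ hrange in
/-- Compatibility of the two comparison maps on `U ×_X V`. [folklore] -/
theorem fst_chartMap₁ :
    pullback.fst u₁.left u₂.left ≫ chartMap₁ B ι₁ ι₂ t e =
      pullback.snd u₁.left u₂.left ≫ chartMap₂ B ι₁ ι₂ t e := by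
  haveI := isIso_toOverlap B ι₁ ι₂ θ u₁ u₂ hψ hrange
  rw [← cancel_epi (toOverlap B ι₁ ι₂ θ u₁ u₂ hψ), ← Category.assoc, ← Category.assoc,
    toOverlap, pullback.lift_fst, pullback.lift_snd, Category.assoc]
  exact whiskerRight_chartMap₁ B ι₁ ι₂ t e θ hθ hcomp

include hθ hcomp hψ hrange in
/-- **The comparison map `X → glued ⊗ Spec B`**, glued from `chartMap₁`, `chartMap₂`. [folklore] -/
def comparison : X.left ⟶ (glued ι₁ ι₂ t e ⊗ specOver A B).left :=
  Scheme.Cover.glueMorphisms (twoCover B u₁ u₂ hcov)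
    (fun b => match b with
      | true => chartMap₁ B ι₁ ι₂ t e
      | false => chartMap₂ B ι₁ ι₂ t e)
    (by
      have key := fst_chartMap₁ B ι₁ ι₂ t e θ hθ hcomp u₁ u₂ hψ hrange
      rintro (_ | _) (_ | _)
      · change pullback.fst u₂.left u₂.left ≫ chartMap₂ B ι₁ ι₂ t e =
          pullback.snd u₂.left u₂.left ≫ chartMap₂ B ι₁ ι₂ t e
        rw [fst_eq_snd_of_mono_eq]
      · change pullback.fst u₂.left u₁.left ≫ chartMap₂ B ι₁ ι₂ t e =
          pullback.snd u₂.left u₁.left ≫ chartMap₁ B ι₁ ι₂ t e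
        rw [← cancel_epi (pullbackSymmetry u₁.left u₂.left).hom, pullbackSymmetry_hom_comp_fst_assoc,
          pullbackSymmetry_hom_comp_snd_assoc, key]
      · exact key
      · change pullback.fst u₁.left u₁.left ≫ chartMap₁ B ι₁ ι₂ t e =
          pullback.snd u₁.left u₁.left ≫ chartMap₁ B ι₁ ι₂ t e
        rw [fst_eq_snd_of_mono_eq])

/-- The comparison map restricted to the first chart. [folklore] -/
theorem u₁_comparison : u₁.left ≫ comparison B ι₁ ι₂ t e θ hθ hcomp u₁ u₂ hψ hrange hcov =
    chartMap₁ B ι₁ ι₂ t e :=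
  Scheme.Cover.ι_glueMorphisms (twoCover B u₁ u₂ hcov) _ _ true

/-- The comparison map restricted to the second chart. [folklore] -/
theorem u₂_comparison : u₂.left ≫ comparison B ι₁ ι₂ t e θ hθ hcomp u₁ u₂ hψ hrange hcov =
    chartMap₂ B ι₁ ι₂ t e :=
  Scheme.Cover.ι_glueMorphisms (twoCover B u₁ u₂ hcov) _ _ false

/-- The comparison map lies over `Spec B`. [folklore] -/
theorem comparison_snd : comparison B ι₁ ι₂ t e θ hθ hcomp u₁ u₂ hψ hrange hcov ≫
    (snd (glued ι₁ ι₂ t e) (specOver A B)).left = X.hom := by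
  refine Scheme.Cover.hom_ext (twoCover B u₁ u₂ hcov) _ _ ?_
  rintro (_ | _)
  · change u₂.left ≫ _ ≫ _ = u₂.left ≫ X.hom
    rw [← Category.assoc, u₂_comparison, chartMap₂, ← Over.comp_left, Category.assoc,
      whiskerRight_snd, toStage_snd, Over.w u₂]
    rfl
  · change u₁.left ≫ _ ≫ _ = u₁.left ≫ X.hom
    rw [← Category.assoc, u₁_comparison, chartMap₁, ← Over.comp_left, Category.assoc,
      whiskerRight_snd, toStage_snd, Over.w u₁]
    rfl

end Comparison

end LocApprox

end Literature.AlgebraicGeometry.Limits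

end
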